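import Literature.AnabelianGeometry.AbsoluteAnabelian.AbsTopIII.Thm19CuspidalDegreeUnique
import Literature.AnabelianGeometry.AbsoluteAnabelian.AbsTopIII.CuspidalSynchronizationHolds
import HarnessLib

/-!
# [AbsTopIII] Prop. 1.6 (iii) / Thm. 1.9 (c): the `Ẑ`-valued cuspidal degree of a class at a cusp
# (`Hom(I_x, M_X) ≅ Ẑ` via THE synchronization) — proof-only companion

Mochizuki, *Topics in Absolute Anabelian Geometry III*, §1, Prop. 1.6 (iii), manuscript p. 35 (lit key
`paper:url-5493eb38cbb7`): "restricting cohomology classes of `Π_U` to the various `I_x` for `x ∈ S`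
[...] yields a natural exact sequence `1 → (k^×)^∧ → H¹(Π_U, M_X) → ⊕_{x ∈ S} Ẑ` — where we identify
`Hom_Ẑ(I_x, M_X)` with `Ẑ` via the isomorphism `I_x ⥲ M_X` of Proposition 1.4, (ii)"; Thm. 1.9 (b)–(c)
p. 37.  abc-iut row «ZHAT-DEGREE» (abc-iut-L4-lead RULING #5s (2), seat abc-iut-L4-t4), sequel of
`Thm19CuspidalDegreeUnique.lean` (p429997): there the INTEGRAL cuspidal degree
(`CurveModel.HasCuspidalDegree`, abc-iut-w5-d213) was shown unique; here the `x`-component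
`H¹(Π_U, M_Z) → Ẑ` of the printed map is made real — every class has a UNIQUE `Ẑ`-valued degree at
every cusp.  All declarations are theorems (no definition, no instance, no named fact):

* the `Ẑ`-scalar action on `M_X = Hom_ℤ(H²(Δ_X, Ẑ), Ẑ)` is Mathlib's existing `LinearMap.module`
  structure on `geomCyclotomeDual F ZHatCoeff` (post-composition, `(c • m) ξ = c · m ξ`), reached through
  the identity wrappers `CyclotomeMod.toDual` / `CyclotomeMod.ofDual`; `ofDual_intCast_smul_toDual`: for
  `c = n ∈ ℤ` it is the `ℤ`-action used by `HasCuspidalDegree`;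
* generic, at a cyclotome presentation `q : Π_{U_x} → Π_X` with `I_x` cuspidally central, a section `s`, a
  bijective differential (`hd`) and `I_x ≅ Ẑ` (`e₀`): `apply_eq_mul_apply_genClass` — every `m ∈ M_X`
  satisfies `m ξ = c_ξ · m ξ₁` for the generator class `ξ₁ = d(e)` (`contHom_apply_eq`,
  `ZHatCoeff.addMonoidHom_apply_eq_mul`); **`exists_eq_smul_inertiaSynchronization`** — every additive
  `φ : I_x → M_X` is `c • sync` for some `c ∈ Ẑ` ("identify `Hom(I_x, M_X)` with `Ẑ` via `I_x ⥲ M_X`");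
  `smul_inertiaSynchronization_injective` — `c` is unique;
* model level, for `P : CuspSyncPresentation h` (NO hypotheses — `Thm_1_9_b_natural` is the tree's
  theorem `thm_1_9_b_natural_holds`): `CuspSyncPresentation.exists_eq_smul_syncAt`,
  `smul_syncAt_injective`, **`CuspSyncPresentation.existsUnique_zhatDegree`** — `∀ η z, ∃! c : Ẑ`, the
  restriction of `η` to `I_z` is the class of `i ↦ c • sync_z(i)`; `hasCuspidalDegree_iff_zhatDegree_intCast`
  — the integral degree `n` of abc-iut-w5-d213 is exactly the case `c = n ∈ ℤ ⊆ Ẑ` ("the submodule of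
  `⊕ ℤ ⊆ ⊕ Ẑ`"); `HasCuspidalDegree.unique'` — uniqueness of the integral degree with NO hypothesis.

HONEST FRAMING: classical bookkeeping (continuous cohomology of a procyclic group with trivial action)
for a refereed, undisputed result, relative to abc-iut-L4-t1's `CurveModel` interface; model-level;
nothing here bears on [IUTchIII] Cor. 3.12.
-/

noncomputable section

open CategoryTheory
open scoped Classical Pointwise

namespace Literature.AnabelianGeometry.AbsoluteAnabelian.AbsTopIII

universe u

/-! ### The `Ẑ`-action on `M_X(Ẑ)` versus the `ℤ`-action -/

/-- `(c • m) ξ = c · m ξ` for the post-composition `Ẑ`-action on `M_X = Hom_ℤ(H²(Δ_X, Ẑ), Ẑ)`.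
[cite: MochizukiAbsTopIII2015, Prop 1.4 (ii) p.31] -/
theorem geomCyclotomeDual_smul_apply (F : FundamentalExtension.{u}) (c : ZHatCoeff.{u})
    (m : geomCyclotomeDual F ZHatCoeff.{u}) (ξ : geomH2 F ZHatCoeff.{u}) : (c • m) ξ = c * m ξ := by
  rw [LinearMap.smul_apply, smul_eq_mul]

/-- For an integer `n`, the `Ẑ`-action by `(n : Ẑ)` on `M_X(Ẑ)` is the `ℤ`-action (the one used by
`CurveModel.HasCuspidalDegree`). [cite: MochizukiAbsTopIII2015, Prop 1.6 (iii) p.35] -/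
theorem CyclotomeMod.ofDual_intCast_smul_toDual (F : FundamentalExtension.{u}) (n : ℤ)
    (m : CyclotomeMod F ZHatCoeff.{u}) :
    CyclotomeMod.ofDual ((n : ZHatCoeff.{u}) • m.toDual) = n • m := by
  apply LinearMap.ext
  intro ξ
  change ((n : ZHatCoeff.{u}) • m.toDual) ξ = (n • m.toDual) ξ
  rw [LinearMap.smul_apply, LinearMap.smul_apply, smul_eq_mul, zsmul_eq_mul]

/-! ### Generic: `Hom(I_x, M_X) ≅ Ẑ` at a cyclotome presentation -/

section Presentation

variable {E F : FundamentalExtension.{u}} (q : E ⟶ F)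

/-- **Every element of `M_X = Hom_ℤ(H²(Δ_X, Ẑ), Ẑ)` is determined by its value on the generator class**
`ξ₁ := d(e)` (the transgression of the chosen isomorphism `e : Ker(Δ^{c-cn}_{U_x} ↠ Δ_X) ≅ Ẑ`):
`m ξ = c_ξ · m ξ₁` with `c_ξ := (d⁻¹ ξ)(e⁻¹ 1)` — every continuous `χ : Ker → Ẑ` is `i ↦ e(i) · χ(e⁻¹ 1)`
(`contHom_apply_eq`) and `c ↦ m(d(e · c))` is additive, hence `c ↦ c · m ξ₁`
(`ZHatCoeff.addMonoidHom_apply_eq_mul`). [cite: MochizukiAbsTopIII2015, Prop 1.4 (ii) p.32] -/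
theorem apply_eq_mul_apply_genClass (s : CcnSection q)
    (hd : Function.Bijective (ccnTransgression q ZHatCoeff.{u} s))
    (e : Additive (ContinuousCohomology.extKer (deltaCcnProjₜ q)) ≃ₜ+ ZHatCoeff.{u})
    (m : geomCyclotomeDual F ZHatCoeff.{u}) (ξ : geomH2 F ZHatCoeff.{u}) :
    m ξ = ((AddEquiv.ofBijective _ hd).symm ξ) (e.symm 1) *
      m (ccnTransgression q ZHatCoeff.{u} s (kerToZHat q e)) := by
  -- `χc c : i ↦ e(i) · c`
  let χc : ZHatCoeff.{u} →
      (Additive (ContinuousCohomology.extKer (deltaCcnProjₜ q)) →ₜ+ ZHatCoeff.{u}) :=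
    fun c => (ZHatCoeff.mulRightₜ c).comp (kerToZHat q e)
  have hχc : ∀ c i, χc c i = e i * c := fun c i => rfl
  -- `c ↦ m (d (χc c))` is additive
  let Fm : ZHatCoeff.{u} →+ ZHatCoeff.{u} :=
    { toFun := fun c => m (ccnTransgression q ZHatCoeff.{u} s (χc c))
      map_zero' := by
        have h0 : χc 0 = 0 := ContinuousAddMonoidHom.ext fun i => by
          rw [hχc, mul_zero]; rfl
        rw [h0, map_zero, map_zero]
      map_add' := fun c c' => by
        have hadd : χc (c + c') = χc c + χc c' := ContinuousAddMonoidHom.ext fun i => by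
          change e i * (c + c') = e i * c + e i * c'
          rw [mul_add]
        rw [hadd, map_add, map_add] }
  have hFm : ∀ c, Fm c = m (ccnTransgression q ZHatCoeff.{u} s (χc c)) := fun c => rfl
  set χ := (AddEquiv.ofBijective _ hd).symm ξ with hχdef
  have hξ : ξ = ccnTransgression q ZHatCoeff.{u} s χ := by
    rw [hχdef]
    exact ((AddEquiv.ofBijective _ hd).apply_symm_apply ξ).symm
  have hχ' : χ = χc (χ (e.symm 1)) :=
    ContinuousAddMonoidHom.ext fun i => by rw [hχc]; exact contHom_apply_eq q e χ i
  have h1 : χc 1 = kerToZHat q e := ContinuousAddMonoidHom.ext fun i => by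
    rw [hχc, mul_one]; rfl
  calc m ξ = m (ccnTransgression q ZHatCoeff.{u} s (χc (χ (e.symm 1)))) := by rw [← hχ', ← hξ]
    _ = Fm (χ (e.symm 1)) := (hFm _).symm
    _ = χ (e.symm 1) * Fm 1 := ZHatCoeff.addMonoidHom_apply_eq_mul Fm _
    _ = χ (e.symm 1) * m (ccnTransgression q ZHatCoeff.{u} s (kerToZHat q e)) := by rw [hFm, h1]

variable {q} {I : Subgroup E.arith}

/-- THE synchronization evaluated on the generator class: `sync(i)(d(e)) = e(i)` (with `I_x` carried into
the kernel by `inertiaToExtKer`). [cite: MochizukiAbsTopIII2015, Prop 1.4 (ii) p.32] -/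
theorem inertiaSynchronization_apply_genClass (hI : I ≤ cuspidalKernel q) (s : CcnSection q)
    (hd : Function.Bijective (ccnTransgression q ZHatCoeff.{u} s))
    (e : Additive (ContinuousCohomology.extKer (deltaCcnProjₜ q)) ≃ₜ+ ZHatCoeff.{u}) (i : Additive I) :
    inertiaSynchronization q hI s hd i (ccnTransgression q ZHatCoeff.{u} s (kerToZHat q e)) =
      e (MonoidHom.toAdditive (inertiaToExtKer hI) i) := by
  change synchronizationOfBijective q s hd (MonoidHom.toAdditive (inertiaToExtKer hI) i)
    (ccnTransgression q ZHatCoeff.{u} s (kerToZHat q e)) = _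
  rw [synchronizationOfBijective_apply_transgression, kerToZHat_apply]

/-- **`Hom(I_x, M_X) ≅ Ẑ` via THE synchronization, existence**: at a cyclotome presentation (`I_x`
cuspidally central in `Π_{U_x} → Π_X`, a section, a bijective differential, `I_x ≅ Ẑ`), every additive
map `φ : I_x → M_X = Hom_ℤ(H²(Δ_X, Ẑ), Ẑ)` is `c • sync` for some `c ∈ Ẑ` — "we identify
`Hom_Ẑ(I_x, M_X)` with `Ẑ` via the isomorphism `I_x ⥲ M_X` of Proposition 1.4, (ii)".
[cite: MochizukiAbsTopIII2015, Prop 1.6 (iii) p.35] -/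
theorem exists_eq_smul_inertiaSynchronization (h : IsCuspidallyCentralExtension q I)
    (hIc : IsClosed (I : Set E.arith)) (s : CcnSection q)
    (hd : Function.Bijective (ccnTransgression q ZHatCoeff.{u} s)) (e₀ : Additive I ≃ₜ+ ZHatCoeff.{u})
    (φ : Additive I →+ geomCyclotomeDual F ZHatCoeff.{u}) :
    ∃ c : ZHatCoeff.{u}, ∀ i : Additive I,
      φ i = c • inertiaSynchronization q h.le_cuspidalKernel s hd i := by
  let e := kerEquivZHatOfInertia h hIc e₀
  -- `T : I_x ≃ Ẑ`, `T i = e (ι i)`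
  let ιA : Additive I →+ Additive (ContinuousCohomology.extKer (deltaCcnProjₜ q)) :=
    MonoidHom.toAdditive (inertiaToExtKer h.le_cuspidalKernel)
  have hιA : Function.Bijective ιA := by
    change Function.Bijective (fun i => MonoidHom.toAdditive (inertiaToExtKer h.le_cuspidalKernel) i)
    exact inertiaToExtKer_bijective h
  let T : Additive I ≃+ ZHatCoeff.{u} := (AddEquiv.ofBijective ιA hιA).trans e.toAddEquiv
  have hT : ∀ i, T i = e (ιA i) := fun i => rfl
  -- evaluation at the generator class, as an additive map
  let ev : geomCyclotomeDual F ZHatCoeff.{u} →+ ZHatCoeff.{u} :=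
    { toFun := fun m => m (ccnTransgression q ZHatCoeff.{u} s (kerToZHat q e))
      map_zero' := rfl
      map_add' := fun _ _ => rfl }
  have hev : ∀ m, ev m = m (ccnTransgression q ZHatCoeff.{u} s (kerToZHat q e)) := fun m => rfl
  let Ψ : ZHatCoeff.{u} →+ ZHatCoeff.{u} := ev.comp (φ.comp T.symm.toAddMonoidHom)
  have hΨ : ∀ i : Additive I,
      φ i (ccnTransgression q ZHatCoeff.{u} s (kerToZHat q e)) = T i * Ψ 1 := by
    intro i
    have h1 := ZHatCoeff.addMonoidHom_apply_eq_mul Ψ (T i)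
    have h2 : Ψ (T i) = φ i (ccnTransgression q ZHatCoeff.{u} s (kerToZHat q e)) := by
      change ev (φ (T.symm (T i))) = _
      rw [AddEquiv.symm_apply_apply, hev]
    rw [← h2, h1]
  refine ⟨Ψ 1, fun i => ?_⟩
  apply LinearMap.ext
  intro ξ
  rw [geomCyclotomeDual_smul_apply, apply_eq_mul_apply_genClass q s hd e (φ i) ξ,
    apply_eq_mul_apply_genClass q s hd e (inertiaSynchronization q h.le_cuspidalKernel s hd i) ξ,
    hΨ i, inertiaSynchronization_apply_genClass h.le_cuspidalKernel s hd e i, ← hT i]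
  ring

/-- **`Hom(I_x, M_X) ≅ Ẑ` via THE synchronization, uniqueness**: if `c • sync = c' • sync` on `I_x` then
`c = c'` (evaluate at the element of `I_x` carried to `1 ∈ Ẑ` and at the generator class).
[cite: MochizukiAbsTopIII2015, Prop 1.6 (iii) p.35] -/
theorem smul_inertiaSynchronization_injective (h : IsCuspidallyCentralExtension q I)
    (hIc : IsClosed (I : Set E.arith)) (s : CcnSection q)
    (hd : Function.Bijective (ccnTransgression q ZHatCoeff.{u} s)) (e₀ : Additive I ≃ₜ+ ZHatCoeff.{u})
    {c c' : ZHatCoeff.{u}}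
    (hcc : ∀ i : Additive I, c • inertiaSynchronization q h.le_cuspidalKernel s hd i =
      c' • inertiaSynchronization q h.le_cuspidalKernel s hd i) : c = c' := by
  let e := kerEquivZHatOfInertia h hIc e₀
  let ιA : Additive I →+ Additive (ContinuousCohomology.extKer (deltaCcnProjₜ q)) :=
    MonoidHom.toAdditive (inertiaToExtKer h.le_cuspidalKernel)
  have hιA : Function.Bijective ιA := by
    change Function.Bijective (fun i => MonoidHom.toAdditive (inertiaToExtKer h.le_cuspidalKernel) i)
    exact inertiaToExtKer_bijective h
  let T : Additive I ≃+ ZHatCoeff.{u} := (AddEquiv.ofBijective ιA hιA).trans e.toAddEquiv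
  have hT : ∀ i, T i = e (ιA i) := fun i => rfl
  have h1 := congrArg (fun m : geomCyclotomeDual F ZHatCoeff.{u} =>
    m (ccnTransgression q ZHatCoeff.{u} s (kerToZHat q e))) (hcc (T.symm 1))
  simp only [geomCyclotomeDual_smul_apply, inertiaSynchronization_apply_genClass] at h1
  rw [← hT, AddEquiv.apply_symm_apply, mul_one, mul_one] at h1
  exact h1

end Presentation

/-! ### Model level: the `Ẑ`-valued cuspidal degree -/

namespace CurveModel

variable {M : CurveModel.{u}} {U Z : M.Curve} {h : M.IsCofiniteOpen U Z} (P : M.CuspSyncPresentation h)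

namespace CuspSyncPresentation

/-- The transport `I_z ⊆ Δ_U ⥲ I_z ⊆ Δ_{U_z}` (Prop. 1.4 (i)) as an additive equivalence.
[cite: MochizukiAbsTopIII2015, Prop 1.4 (i) p.31] -/
theorem toAdditive_inertiaTransport_bijective (z : (M.cusps U).Cusp) :
    Function.Bijective (MonoidHom.toAdditive (P.inertiaTransport z)) := by
  change Function.Bijective (fun i => MonoidHom.toAdditive (P.inertiaTransport z) i)
  exact ⟨fun a b hab => Additive.toMul.injective ((P.inertiaTransport_bijective z).1
      (Additive.ofMul.injective hab)),
    fun b => by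
      obtain ⟨a, ha⟩ := (P.inertiaTransport_bijective z).2 (Additive.toMul b)
      exact ⟨Additive.ofMul a, by simpa using congrArg Additive.ofMul ha⟩⟩

/-- THE synchronization at `z` after the transport, on `toDual` values (definitional unfolding).
[cite: MochizukiAbsTopIII2015, Thm 1.9 (b) p.37] -/
theorem toDual_syncAt (z : (M.cusps U).Cusp) (i : Additive ((M.cusps U).Icusp z)) :
    (P.syncAt z i).toDual =
      inertiaSynchronization (M.res (P.hZ z)) (P.pres z).isCuspidallyCentral.le_cuspidalKernel (P.sec z)
        (P.bij z) (MonoidHom.toAdditive (P.inertiaTransport z) i) :=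
  rfl

/-- **Every additive map `φ : I_z → M_Z` is `c • sync_z` for some `c ∈ Ẑ`** (THE synchronization of Thm.
1.9 (b) at the cusp `z` of `U`; no hypothesis: the presentation supplies `I ≅ Ẑ` via
`nonempty_inertiaEquivZHat`). [cite: MochizukiAbsTopIII2015, Prop 1.6 (iii) p.35] -/
theorem exists_eq_smul_syncAt (z : (M.cusps U).Cusp)
    (φ : Additive ((M.cusps U).Icusp z) →+ CyclotomeMod (M.ext Z) ZHatCoeff.{u}) :
    ∃ c : ZHatCoeff.{u}, ∀ i, (φ i).toDual = c • (P.syncAt z i).toDual := by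
  obtain ⟨e₀⟩ := M.nonempty_inertiaEquivZHat (P.hZ z) (P.cusp z) (P.pres z)
  have hIc := (M.cusps (P.Uz z)).isClosed_Icusp (P.cusp z)
  let τ : Additive ((M.cusps U).Icusp z) ≃+ Additive ((M.cusps (P.Uz z)).Icusp (P.cusp z)) :=
    AddEquiv.ofBijective _ (P.toAdditive_inertiaTransport_bijective z)
  have hτ : ∀ i, τ i = MonoidHom.toAdditive (P.inertiaTransport z) i := fun i => rfl
  -- transport `φ` to the inertia group of the presentation
  let φ₀ : Additive ((M.cusps (P.Uz z)).Icusp (P.cusp z)) →+ geomCyclotomeDual (M.ext Z) ZHatCoeff.{u} :=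
    { toFun := fun j => (φ (τ.symm j)).toDual
      map_zero' := by rw [map_zero, map_zero]; rfl
      map_add' := fun a b => by rw [map_add, map_add]; rfl }
  have hφ₀ : ∀ j, φ₀ j = (φ (τ.symm j)).toDual := fun j => rfl
  obtain ⟨c, hc⟩ := exists_eq_smul_inertiaSynchronization (P.pres z).isCuspidallyCentral hIc (P.sec z)
    (P.bij z) e₀ φ₀
  refine ⟨c, fun i => ?_⟩
  have h1 := hc (τ i)
  rw [hφ₀, AddEquiv.symm_apply_apply, hτ] at h1
  rw [h1, toDual_syncAt]

/-- **Uniqueness of the scalar**: `c • sync_z = c' • sync_z` on `I_z` implies `c = c'`.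
[cite: MochizukiAbsTopIII2015, Prop 1.6 (iii) p.35] -/
theorem smul_syncAt_injective (z : (M.cusps U).Cusp) {c c' : ZHatCoeff.{u}}
    (hcc : ∀ i : (M.cusps U).Icusp z,
      c • (P.syncAt z (Additive.ofMul i)).toDual = c' • (P.syncAt z (Additive.ofMul i)).toDual) :
    c = c' := by
  obtain ⟨e₀⟩ := M.nonempty_inertiaEquivZHat (P.hZ z) (P.cusp z) (P.pres z)
  have hIc := (M.cusps (P.Uz z)).isClosed_Icusp (P.cusp z)
  refine smul_inertiaSynchronization_injective (P.pres z).isCuspidallyCentral hIc (P.sec z) (P.bij z) e₀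
    fun j => ?_
  obtain ⟨i, hi⟩ := (P.toAdditive_inertiaTransport_bijective z).2 j
  have h1 := hcc (Additive.toMul i)
  rw [ofMul_toMul, toDual_syncAt, hi] at h1
  exact h1

/-- **The `Ẑ`-valued cuspidal degree exists and is unique** ([AbsTopIII] Prop. 1.6 (iii): the
`x`-component `H¹(Π_U, M_X) → Ẑ` of "`H¹(Π_U, M_X) → ⊕_{x ∈ S} Ẑ` — where we identify `Hom_Ẑ(I_x, M_X)`
with `Ẑ` via the isomorphism `I_x ⥲ M_X`"): for every `η ∈ H¹(Π_U, M_Z)` and every cusp `z` of `U`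
there is a unique `c ∈ Ẑ` such that the restriction of `η` to `I_z` is the class of the continuous
homomorphism `i ↦ c • sync_z(i)` (`I_z` acts trivially on `M_Z`).  No hypothesis beyond the
presentation data `P`. [cite: MochizukiAbsTopIII2015, Prop 1.6 (iii) p.35] -/
theorem existsUnique_zhatDegree (η : cyclotomeModH1 (M.res h) ZHatCoeff.{u}) (z : (M.cusps U).Cusp) :
    ∃! c : ZHatCoeff.{u},
      ∃ (hc : Continuous fun i : (M.cusps U).Icusp z =>
          CyclotomeMod.ofDual (c • (P.syncAt z (Additive.ofMul i)).toDual))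
        (hf : ∀ x y : (M.cusps U).Icusp z,
          (⟨_, hc⟩ : C((M.cusps U).Icusp z, M.inertiaRep h z)) (x * y) =
            (⟨_, hc⟩ : C((M.cusps U).Icusp z, M.inertiaRep h z)) x +
              (M.inertiaRep h z).ρ x ((⟨_, hc⟩ : C((M.cusps U).Icusp z, M.inertiaRep h z)) y)),
        cyclotomeModH1Res (M.res h) ZHatCoeff.{u} ((M.cusps U).Icusp z) η =
          ContinuousCohomology.crossedHomClass (M.inertiaRep h z) ⟨_, hc⟩ hf := by
  -- existence: the restriction is the class of SOME continuous crossed homomorphism `f` ...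
  obtain ⟨f, hf, hfc⟩ := ContinuousCohomology.exists_crossedHomClass_eq (M.inertiaRep h z)
    (cyclotomeModH1Res (M.res h) ZHatCoeff.{u} ((M.cusps U).Icusp z) η)
  -- ... which is a homomorphism, the action being trivial ...
  have hadd : ∀ x y, f (x * y) = f x + f y := fun x y => by
    rw [hf x y, M.inertiaRep_ρ_apply h z]
  let φ : Additive ((M.cusps U).Icusp z) →+ CyclotomeMod (M.ext Z) ZHatCoeff.{u} :=
    { toFun := fun i => f (Additive.toMul i)
      map_zero' := by
        have h11 := hadd 1 1
        rw [mul_one, left_eq_add] at h11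
        exact h11
      map_add' := fun a b => hadd (Additive.toMul a) (Additive.toMul b) }
  have hφ : ∀ i, φ (Additive.ofMul i) = f i := fun i => rfl
  -- ... hence `c • sync_z`
  obtain ⟨c, hc⟩ := P.exists_eq_smul_syncAt z φ
  have hfun : (fun i : (M.cusps U).Icusp z =>
      CyclotomeMod.ofDual (c • (P.syncAt z (Additive.ofMul i)).toDual)) = f := by
    funext i
    rw [← hc (Additive.ofMul i), hφ]
    rfl
  have hcont : Continuous fun i : (M.cusps U).Icusp z =>
      CyclotomeMod.ofDual (c • (P.syncAt z (Additive.ofMul i)).toDual) := by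
    rw [hfun]; exact f.continuous
  have hF : (⟨_, hcont⟩ : C((M.cusps U).Icusp z, M.inertiaRep h z)) = f := ContinuousMap.ext fun i => by
    change CyclotomeMod.ofDual (c • (P.syncAt z (Additive.ofMul i)).toDual) = f i
    exact congrFun hfun i
  have hf' : ∀ x y : (M.cusps U).Icusp z,
      (⟨_, hcont⟩ : C((M.cusps U).Icusp z, M.inertiaRep h z)) (x * y) =
        (⟨_, hcont⟩ : C((M.cusps U).Icusp z, M.inertiaRep h z)) x +
          (M.inertiaRep h z).ρ x ((⟨_, hcont⟩ : C((M.cusps U).Icusp z, M.inertiaRep h z)) y) := by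
    rw [hF]; exact hf
  refine ⟨c, ⟨hcont, hf', hfc.symm.trans (crossedHomClass_congr _ hF.symm hf hf')⟩, ?_⟩
  -- uniqueness
  rintro c' ⟨hc', hf'', heq'⟩
  refine (P.smul_syncAt_injective z fun i => ?_).symm
  have hclass : ContinuousCohomology.crossedHomClass (M.inertiaRep h z) ⟨_, hcont⟩ hf' =
      ContinuousCohomology.crossedHomClass (M.inertiaRep h z) ⟨_, hc'⟩ hf'' := by
    rw [← heq']
    exact (hfc.symm.trans (crossedHomClass_congr _ hF.symm hf hf')).symm
  have hff := ContinuousCohomology.eq_of_crossedHomClass_eq (M.inertiaRep h z)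
    (M.inertiaRep_ρ_apply h z) hf' hf'' hclass
  have hi := congrArg (fun F : C((M.cusps U).Icusp z, M.inertiaRep h z) => (F i : M.inertiaRep h z)) hff
  exact congrArg CyclotomeMod.toDual hi

/-- **Integral degree = `Ẑ`-degree in `ℤ ⊆ Ẑ`** ("the submodule of `⊕ ℤ ⊆ ⊕ Ẑ`", Prop. 1.6 (iii)):
abc-iut-w5-d213's `HasCuspidalDegree P η z n` holds iff `(n : Ẑ)` is a `Ẑ`-valued cuspidal degree of
`η` at `z`. [cite: MochizukiAbsTopIII2015, Prop 1.6 (iii) p.35] -/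
theorem hasCuspidalDegree_iff_zhatDegree_intCast (η : cyclotomeModH1 (M.res h) ZHatCoeff.{u})
    (z : (M.cusps U).Cusp) (n : ℤ) :
    HasCuspidalDegree P η z n ↔
      ∃ (hc : Continuous fun i : (M.cusps U).Icusp z =>
          CyclotomeMod.ofDual (((n : ZHatCoeff.{u})) • (P.syncAt z (Additive.ofMul i)).toDual))
        (hf : ∀ x y : (M.cusps U).Icusp z,
          (⟨_, hc⟩ : C((M.cusps U).Icusp z, M.inertiaRep h z)) (x * y) =
            (⟨_, hc⟩ : C((M.cusps U).Icusp z, M.inertiaRep h z)) x +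
              (M.inertiaRep h z).ρ x ((⟨_, hc⟩ : C((M.cusps U).Icusp z, M.inertiaRep h z)) y)),
        cyclotomeModH1Res (M.res h) ZHatCoeff.{u} ((M.cusps U).Icusp z) η =
          ContinuousCohomology.crossedHomClass (M.inertiaRep h z) ⟨_, hc⟩ hf := by
  have hfun : (fun i : (M.cusps U).Icusp z =>
      CyclotomeMod.ofDual (((n : ZHatCoeff.{u})) • (P.syncAt z (Additive.ofMul i)).toDual)) =
        fun i : (M.cusps U).Icusp z => n • P.syncAt z (Additive.ofMul i) := by
    funext i
    exact CyclotomeMod.ofDual_intCast_smul_toDual (M.ext Z) n _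
  constructor
  · rintro ⟨hc, hf, heq⟩
    have hc' : Continuous fun i : (M.cusps U).Icusp z =>
        CyclotomeMod.ofDual (((n : ZHatCoeff.{u})) • (P.syncAt z (Additive.ofMul i)).toDual) := by
      rw [hfun]; exact hc
    have hF : (⟨_, hc'⟩ : C((M.cusps U).Icusp z, M.inertiaRep h z)) = ⟨_, hc⟩ :=
      ContinuousMap.ext fun i => congrFun hfun i
    refine ⟨hc', fun x y => by rw [hF]; exact hf x y, ?_⟩
    rw [heq]
    exact (crossedHomClass_congr _ hF _ _).symm
  · rintro ⟨hc, hf, heq⟩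
    have hc' : Continuous fun i : (M.cusps U).Icusp z => n • P.syncAt z (Additive.ofMul i) := by
      rw [← hfun]; exact hc
    have hF : (⟨_, hc'⟩ : C((M.cusps U).Icusp z, M.inertiaRep h z)) = ⟨_, hc⟩ :=
      ContinuousMap.ext fun i => (congrFun hfun i).symm
    refine ⟨hc', fun x y => by rw [hF]; exact hf x y, ?_⟩
    rw [heq]
    exact (crossedHomClass_congr _ hF _ _).symm

end CuspSyncPresentation

/-- **Uniqueness of the integral cuspidal degree, unconditionally** (the hypothesis `Thm_1_9_b_natural`
of `hasCuspidalDegree_unique` is the tree's theorem `thm_1_9_b_natural_holds`).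
[cite: MochizukiAbsTopIII2015, Thm 1.9 (c) p.37] -/
theorem HasCuspidalDegree.unique' {η : cyclotomeModH1 (M.res h) ZHatCoeff.{u}} {z : (M.cusps U).Cusp}
    {n n' : ℤ} (hn : HasCuspidalDegree P η z n) (hn' : HasCuspidalDegree P η z n') : n = n' :=
  HasCuspidalDegree.unique P (P.syncAt_bijective M.thm_1_9_b_natural_holds z).1 hn hn'

/-- The degree function of a class in `PUgt` is unique, unconditionally.
[cite: MochizukiAbsTopIII2015, Thm 1.9 (c) p.37] -/
theorem HasCuspidalDegree.degreeFun_unique' {η : cyclotomeModH1 (M.res h) ZHatCoeff.{u}}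
    {D D' : (M.cusps U).Cusp → ℤ} (hD : ∀ z, HasCuspidalDegree P η z (D z))
    (hD' : ∀ z, HasCuspidalDegree P η z (D' z)) : D = D' :=
  HasCuspidalDegree.degreeFun_unique_of_thm19bNatural P M.thm_1_9_b_natural_holds hD hD'

end CurveModel

end Literature.AnabelianGeometry.AbsoluteAnabelian.AbsTopIII

end
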